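import Summits.BirchSwinnertonDyer.BirchSwinnertonDyer.Theorems.ByReductionTypeAtTwoSupersingularFlatOrthogonalityLayer
import Summits.BirchSwinnertonDyer.BirchSwinnertonDyer.Theorems.KatoDescentPotSupersingularSelmerInftyDirectLimit
import Literature.NumberTheory.EllipticCurves.Greenberg1999.KummerImageMultiplicativeTateProofs
import Literature.NumberTheory.EllipticCurves.Kato2004.IwasawaCohomology
import Literature.NumberTheory.EllipticCurves.Sprung2012.SharpFlatSelmer
import HarnessLib

/-!
# Route `ByReductionTypeAtTwo` (rung K4), crux `SupersingularRankZeroAtTwo` (item stmt-BirchSwinnertonDyer-19097), line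
# `odd_blind_package` v2.17/v2.18, stub `stub_flatPackage`, conjunct (8), clause F1♭ `Exact loc toX` — the half
# «`range loc ⊆ ker toX`» (T-ORTH), PART 3: **T-ORTH ITSELF — the Kummer values of `loc x` on Selmer data VANISH, and
# `toX (Col♭ (loc x)) = 0`** (cell `bsd-2adic`, seat `bsd-2adic-tower-1` GEN 68, hand hF1♭-ORTH; `--supports 19097`, helper)

HONEST FRAMING (D-0054): THEOREMS ONLY — no definition, no named fact, no instance, no `sorry`.  Helper toward conjunct (8);
closes NO stub; 19097 stays OPEN on its 5 registered stubs; nothing booked; BSD₂ is proved for no supersingular curve and BSD for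
no curve by any of this; typed ≠ proved.  Generic prime `p`; NO `2 •` in any conclusion.

## What and why

Conjunct (8) displays `Function.Exact loc toX` for `loc := Col♭ ∘ₗ L` (`L` = the `Λ`-linear localisation of
`SSFlatPackage.exists_linearMap_pairFun_tatePairing`, p830262, PINNED by its residue clause
«`toZModPow k (L x Q) = CyclotomicLayer.tatePairingPk n k (proj_n x) Q`») and the contract's `toX` (p831519, (V̄): `D.toDual (toX (Col♭ w)) s
= w(p^k Q)/p^k` on Kummer data).  Its half «`range loc ⊆ ker toX`» is, after (V̄) and the injectivity of `D.toDual`, the statement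
T-ORTH: **for `x ∈ 𝐇¹_Γ(T_pW)` and a Selmer class `s ∈ Sel_{p^∞}(E/ℚ_∞)` with a Kummer datum `(φ, Q, k)` at the place of `ℚ_∞` above
`v ∣ p` (`φ|_{Gal(ℚ̄_v/ℚ_∞·ℚ_v)}` = the Kummer cocycle of `Q`, `p^k Q ∈ E(ℚ_∞·ℚ_v)`), `L x (p^k Q) ≡ 0 (mod p^k)`** — global reciprocity,
with NO factor `2` (t42's predicate ORTH, VERBATIM, for `w := L x`).  Proof (§2): the Selmer class comes from a layer, `s = h_m(y)`,
`y ∈ Sel_{p^∞}(E/ℚ_m)` (`FineSelmerLeSignedSelmer.mem_selmerInfty_iff_exists_layer` — `Sel(E/ℚ_∞) = ⋃ res Sel(E/ℚ_m)`); a cocycle `φ_m` of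
`y` restricts to `φ + ∂B` (`B ∈ E[p^∞]`); the CLASSICAL local condition of `y` at `v` gives `P ∈ E(ℚ̄_v)` with `ι φ_m(τ) = τP − P` on
`Gal(ℚ̄_v/ℚ_{m,v})` (`GreenbergVatsalSelmerLink.oneCocycleClass_mem_localKerOver_iff`), `p^{L₀} P ∈ E(ℚ_{m,v})` for `p^{L₀}` killing `φ_m`;
the EXACT layer PT-orth `tatePairingPk_eq_zero_of_selmerLayer` (Part 2) and the residue clause give `L x (p^{L₀} P) ≡ 0 (mod p^{L₀})`; finally
`R := P − Q − ιB ∈ E(ℚ_∞·ℚ_v)` and `p^{L₀} P = p^{L₀−k}(p^k Q) + p^{L₀} R` give `L x (p^k Q) ≡ 0 (mod p^k)`.  §3: the corollary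
`toX (J (L x)) = 0` for every `toX` with the values (V̄) on ♭-Selmer data (injectivity of `D.toDual`, one Kummer datum of `s` from Def. 7.11
at `σ = 1`) — i.e. `range (Col♭ ∘ L) ⊆ ker toX`, the (⊆₁) input of the exactness assembly `…FlatExactAssembly.lean`.

## What is proved
* §1 `exists_sub_eq_smul_sub_of_resOfLe_oneCocycleClass_eq` (two cocycles with the same restricted class differ by a coboundary),
  `exists_pow_nsmul_apply_eq_zero` (one power of `p` kills a continuous `E[p^∞]`-valued cocycle on a compact group).
* §2 ★★ `toZModPow_apply_eq_zero_of_mem_selmerInfty` — T-ORTH for EVERY Selmer class of `Sel_{p^∞}(E/ℚ_∞)` (not only ♭), every prime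
  `p`, cyclotomic `κ`, `v ∣ p`, any pin `I`, any `L` with the residue clause; ★ `orth_of_residue` — t42's ORTH predicate verbatim for
  `w := L x` and `s ∈ Sel♭`.
* §3 ★ `toX_snd_apply_eq_zero` — `toX (J (L x)) = 0` for any `J`, any ♭ dual datum `D` (any key) and any `toX` with the values (V̄).

References: [Kobayashi2003] (7.16)–(7.21) (p. 12), (8.23) (p. 18); [Kato2004Asterisque] §17.13 (p. 279); [GreenbergLNM1716] §1 (p. 60),
§2 Prop. 2.1 and pp. 75–76, §3 Lemmas 3.2–3.3; [Mazur1972] §6; [Sprung2012] Def. 7.9, Lemma 7.10, Def. 7.11 (p. 1503); [MilneADT2006]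
Ch. I Thm. 4.10 (b); [SerreGaloisCohomology1997] I §2.2–2.5; [PerrinRiou1994Invent] §3.6.1.
-/

set_option autoImplicit false
-- the Theorems namespace of this sub repeats the summit name by design (D-0017 nested layout)
set_option linter.dupNamespace false

noncomputable section

open scoped Classical NumberField

namespace Summit.BirchSwinnertonDyer.BirchSwinnertonDyer.Theorems

namespace SSFlatPT

open CategoryTheory NumberField IsDedekindDomain Field WeierstrassCurve ContinuousCohomology
  Literature.NumberTheory.EllipticCurves Literature.NumberTheory.EllipticCurves.GreenbergSelmer
  Literature.NumberTheory.EllipticCurves.Kobayashi2003 Literature.NumberTheory.EllipticCurves.Sprung2012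
  Literature.NumberTheory.EllipticCurves.Sprung2017
  Literature.NumberTheory.EllipticCurves.Kato2004 Literature.NumberTheory.EllipticCurves.Kato2004.EulerSystemValues
  Literature.NumberTheory.GaloisRepresentations Literature.NumberTheory.GaloisRepresentations.DiscreteGaloisModule
  Literature.NumberTheory.GaloisCohomology ZpExtension

/-! ## §1 Two cocycle lemmas -/

section Cocycle

universe u

variable {G : Type u} [Group G] [TopologicalSpace G] [IsTopologicalGroup G]
  {M : Type u} [AddCommGroup M] [DistribMulAction G M] [TopologicalSpace M] [DiscreteTopology M]

/-- **Two cocycles with the same restricted class differ by a coboundary**: if `res_{H}[φ'] = [φ]` for `H ≤ H'`, then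
`φ'(x) − φ(x) = x • a − a` on `H` for some `a ∈ M` (`map_oneCocycleClass`, `oneCocycleClass_eq_zero_iff`).
[cite: SerreGaloisCohomology1997, I §2.4–2.5] -/
theorem exists_sub_eq_smul_sub_of_resOfLe_oneCocycleClass_eq {H H' : Subgroup G} (h : H ≤ H')
    (φ' : contOneCocycles (discreteTopRep H' M)) (φ : contOneCocycles (discreteTopRep H M))
    (heq : resOfLe M h (oneCocycleClass _ φ') = oneCocycleClass _ φ) :
    ∃ a : M, ∀ x : H, φ'.1 (Subgroup.inclusion h x) - φ.1 x = (x : G) • a - a := by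
  have h0 : resOfLe M h (oneCocycleClass _ φ') - oneCocycleClass _ φ = 0 := sub_eq_zero.mpr heq
  change ContinuousCohomology.map (subgroupInclusion h)
      (resHomOfEquivariant (subgroupInclusion h) (AddMonoidHom.id M) (fun _ _ ↦ rfl)) 1 (oneCocycleClass _ φ') -
    oneCocycleClass _ φ = 0 at h0
  rw [map_oneCocycleClass, ← oneCocycleClass_sub, oneCocycleClass_eq_zero_iff] at h0
  obtain ⟨a, ha⟩ := h0
  exact ⟨a, fun x ↦ ha x⟩

/-- **A continuous cocycle on a COMPACT group with `p`-primary values is killed by one power of `p`** (its image is finite).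
[cite: GreenbergLNM1716, §1 (after Conj. 1.3)] -/
theorem exists_pow_nsmul_apply_eq_zero {K : Type u} [Field K] (W : WeierstrassCurve K) (p : ℕ)
    (U : Subgroup (absoluteGaloisGroup K)) [CompactSpace U]
    (φ : contOneCocycles (discreteTopRep U (W.geomPrimaryTorsion p))) :
    ∃ k : ℕ, ∀ x : U, (p ^ k : ℕ) • ((φ.1 x : W.geomPrimaryTorsion p) : W.geomPoints) = 0 := by
  have hfin : (Set.range φ.1).Finite := (isCompact_range φ.1.continuous).finite_of_discrete
  let e : W.geomPrimaryTorsion p → ℕ := fun m ↦ ((AddCommGroup.mem_primaryComponent).1 m.2).choose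
  have he : ∀ m : W.geomPrimaryTorsion p, (p ^ e m : ℕ) • (m : W.geomPoints) = 0 := fun m ↦
    ((AddCommGroup.mem_primaryComponent).1 m.2).choose_spec
  refine ⟨hfin.toFinset.sup e, fun x ↦ ?_⟩
  have hle : e (φ.1 x) ≤ hfin.toFinset.sup e := Finset.le_sup (hfin.mem_toFinset.mpr ⟨x, rfl⟩)
  obtain ⟨d, hd⟩ := Nat.exists_eq_add_of_le hle
  rw [hd, pow_add, mul_nsmul, he, nsmul_zero]

end Cocycle

/-! ## §2 T-ORTH: the Kummer values of `L x` on Selmer data VANISH (`x ∈ 𝐇¹_Γ(T_pW)`, any Selmer class of `E/ℚ_∞`) -/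

section Orth

variable (W : WeierstrassCurve ℚ) [W.IsElliptic] {p : ℕ} [hp : Fact p.Prime] [ContinuousSMul ℤ_[p] (W.tateModule p)]
  (κ : ZpExtension ℚ p) (v : HeightOneSpectrum (𝓞 ℚ))

/-- ★★ **T-ORTH: the Kummer values of `L x` on Selmer data vanish** — for the cyclotomic `ℤ_p`-extension of `ℚ`, `v ∣ p`, any pin
`I : IwasawaH1Data W p κ γ`, any `L : I.H → Hom(E(ℚ_∞·ℚ_v), ℤ_p)` with the residue clause
«`toZModPow k (L x Q) = CyclotomicLayer.tatePairingPk n k (proj_n x) Q`» (p830262), every `x ∈ I.H`, every Selmer class `s ∈ Sel_{p^∞}(E/ℚ_∞)`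
with a cocycle `φ`, and every Kummer datum `(Q, k)` of `φ` at the chosen place (`p^k Q ∈ E(ℚ_∞·ℚ_v)`, `ι φ(τ) = τQ − Q` on
`Gal(ℚ̄_v/ℚ_∞·ℚ_v)`): `L x (p^k Q) ≡ 0 (mod p^k)`.  NO factor `2`, every prime `p`.  Proof: module docstring §2.
[cite: Kobayashi2003, (7.16)–(7.21) (p. 12), (8.23) (p. 18)] [cite: Kato2004Asterisque, §17.13 (p. 279)] [cite: GreenbergLNM1716, §3 Lemmas 3.2–3.3]
[cite: MilneADT2006, Ch. I, Thm. 4.10(b)] -/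
theorem toZModPow_apply_eq_zero_of_mem_selmerInfty (hκ : κ.IsCyclotomic) (hv : (p : 𝓞 ℚ) ∈ v.asIdeal)
    {γ : absoluteGaloisGroup ℚ} (I : IwasawaH1Data W p κ γ)
    (L : I.H → (localTowerPointsOfEmb κ (closureEmb (K := ℚ) (v.adicCompletion ℚ)) W →+ ℤ_[p]))
    (hL : ∀ (x : I.H) (n k : ℕ) (Q : localPoints W (v.adicCompletion ℚ))
        (hQ : Q ∈ localLayerPointsOfEmb κ (closureEmb (K := ℚ) (v.adicCompletion ℚ)) W n),
        PadicInt.toZModPow k (L x ⟨Q, localLayerPointsOfEmb_le_localTowerPointsOfEmb κ _ W n hQ⟩) =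
          CyclotomicLayer.tatePairingPk W κ v n k (I.proj n x) ⟨Q, hQ⟩)
    (x : I.H) {s : W.subgroupH1 p κ.kerSubgroup} (hs : s ∈ W.selmerInfty κ)
    (φ : contOneCocycles (discreteTopRep κ.kerSubgroup (W.geomPrimaryTorsion p)))
    (hφ : oneCocycleClass (discreteTopRep κ.kerSubgroup (W.geomPrimaryTorsion p)) φ = s)
    (Q : localPoints W (v.adicCompletion ℚ)) (k : ℕ)
    (hQ : (p ^ k) • Q ∈ localTowerPointsOfEmb κ (closureEmb (K := ℚ) (v.adicCompletion ℚ)) W)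
    (hKum : ∀ τ : localSubgroupOfEmb κ.kerSubgroup (closureEmb (K := ℚ) (v.adicCompletion ℚ)),
      pointsMapOfEmb W (closureEmb (K := ℚ) (v.adicCompletion ℚ))
          ((φ.1 (resGalSubgroupOfEmb κ.kerSubgroup _ τ) : W.geomPrimaryTorsion p) : W.geomPoints) =
        (τ : absoluteGaloisGroup (v.adicCompletion ℚ)) • Q - Q) :
    PadicInt.toZModPow k (L x ⟨(p ^ k) • Q, hQ⟩) = 0 := by
  haveI : CompactSpace (absoluteGaloisGroup ℚ) := absoluteGaloisGroup_compactSpace ℚ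
  -- (a) the Selmer class comes from a layer: `s = h_m(y)`, `y ∈ Sel(E/ℚ_m)`, with a cocycle `φ_m`
  obtain ⟨m, y, hy, hys⟩ := (FineSelmerLeSignedSelmer.mem_selmerInfty_iff_exists_layer W κ s).1 hs
  obtain ⟨φm, rfl⟩ := oneCocycleClass_surjective _ y
  -- (b) `φ_m|_{Γ_∞} − φ = ∂B`
  obtain ⟨B, hB⟩ := exists_sub_eq_smul_sub_of_resOfLe_oneCocycleClass_eq (κ.kerSubgroup_le_layerSubgroup m) φm φ
    (hys.trans hφ.symm)
  -- (c) the classical local condition of `y` at `v`: `(closureEmb (K := ℚ) (v.adicCompletion ℚ)) φ_m(res τ) = τ P − P` on `Gal(ℚ̄_v/ℚ_{m,v})`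
  have hloc : oneCocycleClass _ φm ∈ W.localKerOver p (κ.layerSubgroup m) (v.adicCompletion ℚ) := by
    have h := ((W.mem_selmerGroupOver_iff p (κ.layerSubgroup m) _).1 hy).1 v 1
    rwa [W.conjH1_one_holds p (κ.layerSubgroup m), AddMonoidHom.id_apply] at h
  obtain ⟨P, hP⟩ := (Greenberg1999.GreenbergVatsalSelmerLink.oneCocycleClass_mem_localKerOver_iff W p
    (κ.layerSubgroup m) (v.adicCompletion ℚ) φm).1 hloc
  -- (d) one exponent killing `φ_m` pointwise, `B`, and `≥ k`
  haveI : CompactSpace (κ.layerSubgroup m) :=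
    isCompact_iff_compactSpace.mp ((κ.layerSubgroup m).isClosed_of_isOpen (κ.isOpen_layerSubgroup m)).isCompact
  obtain ⟨L₁, hL₁⟩ := exists_pow_nsmul_apply_eq_zero W p (κ.layerSubgroup m) φm
  obtain ⟨j, hj⟩ := (AddCommGroup.mem_primaryComponent).1 B.2
  set L₀ : ℕ := L₁ + j + k with hL₀
  have hkill : ∀ y : κ.layerSubgroup m, (p ^ L₀ : ℕ) • ((φm.1 y : W.geomPrimaryTorsion p) : W.geomPoints) = 0 := fun y ↦ by
    rw [hL₀, add_assoc, pow_add, mul_nsmul, hL₁ y, nsmul_zero]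
  have hBkill : (p ^ L₀ : ℕ) • (B : W.geomPoints) = 0 := by
    rw [hL₀, show L₁ + j + k = j + (L₁ + k) by ring, pow_add, mul_nsmul, hj, nsmul_zero]
  -- (e) `p^{L₀} P ∈ E(ℚ_{m,v})`
  have hP' : (p ^ L₀ : ℕ) • P ∈ localLayerPointsOfEmb κ (closureEmb (K := ℚ) (v.adicCompletion ℚ)) W m := by
    rw [mem_localLayerPointsOfEmb_iff]
    intro τ hτ
    have e := hP ⟨τ, hτ⟩
    have e0 : (p ^ L₀ : ℕ) • ((τ : absoluteGaloisGroup (v.adicCompletion ℚ)) • P - P) = 0 := by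
      rw [← e, ← map_nsmul, hkill, map_zero]
    rw [nsmul_sub, sub_eq_zero] at e0
    rw [smul_comm, e0]
  -- (f) the exact layer PT-orth at layer `m`, level `L₀`, for `proj_m x` and `φ_m`, `P`
  have hlayer := tatePairingPk_eq_zero_of_selmerLayer W κ m hκ v hv L₀ (I.proj m x) hy φm rfl hkill P hP'
    (fun τ ↦ hP τ)
  have hval : PadicInt.toZModPow L₀ (L x ⟨(p ^ L₀ : ℕ) • P, localLayerPointsOfEmb_le_localTowerPointsOfEmb κ _ W m hP'⟩) = 0 := by
    rw [hL x m L₀ _ hP', hlayer]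
  -- (g) `R := P − Q − (closureEmb (K := ℚ) (v.adicCompletion ℚ)) B` is fixed by `Gal(ℚ̄_v/ℚ_∞·ℚ_v)`
  have hR : P - Q - pointsMapOfEmb W (closureEmb (K := ℚ) (v.adicCompletion ℚ)) (B : W.geomPoints) ∈ localTowerPointsOfEmb κ (closureEmb (K := ℚ) (v.adicCompletion ℚ)) W := by
    rw [mem_localTowerPointsOfEmb_iff]
    intro τ hτ
    have e1 := hP ⟨τ, κ.kerSubgroup_le_layerSubgroup m hτ⟩
    have e2 : pointsMapOfEmb W (closureEmb (K := ℚ) (v.adicCompletion ℚ)) ((φ.1 (resGalSubgroupOfEmb κ.kerSubgroup (closureEmb (K := ℚ) (v.adicCompletion ℚ)) ⟨τ, hτ⟩) : W.geomPrimaryTorsion p) :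
        W.geomPoints) = τ • Q - Q := hKum ⟨τ, hτ⟩
    have e3 := hB (resGalSubgroupOfEmb κ.kerSubgroup (closureEmb (K := ℚ) (v.adicCompletion ℚ)) ⟨τ, hτ⟩)
    -- `(closureEmb (K := ℚ) (v.adicCompletion ℚ))(φ_m(res τ)) − (closureEmb (K := ℚ) (v.adicCompletion ℚ))(φ(res τ)) = τ ιB − ιB`
    have e4 : pointsMapOfEmb W (closureEmb (K := ℚ) (v.adicCompletion ℚ)) ((φm.1 (Subgroup.inclusion (κ.kerSubgroup_le_layerSubgroup m)
          (resGalSubgroupOfEmb κ.kerSubgroup (closureEmb (K := ℚ) (v.adicCompletion ℚ)) ⟨τ, hτ⟩)) : W.geomPrimaryTorsion p) : W.geomPoints) -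
        pointsMapOfEmb W (closureEmb (K := ℚ) (v.adicCompletion ℚ)) ((φ.1 (resGalSubgroupOfEmb κ.kerSubgroup (closureEmb (K := ℚ) (v.adicCompletion ℚ)) ⟨τ, hτ⟩) : W.geomPrimaryTorsion p) : W.geomPoints) =
        τ • pointsMapOfEmb W (closureEmb (K := ℚ) (v.adicCompletion ℚ)) (B : W.geomPoints) - pointsMapOfEmb W (closureEmb (K := ℚ) (v.adicCompletion ℚ)) (B : W.geomPoints) := by
      rw [← map_sub, ← AddSubgroupClass.coe_sub, e3, AddSubgroupClass.coe_sub, primaryComponent.coe_smul, map_sub,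
        ← pointsMapOfEmb_smul]
      rfl
    have e1' : pointsMapOfEmb W (closureEmb (K := ℚ) (v.adicCompletion ℚ)) ((φm.1 (Subgroup.inclusion (κ.kerSubgroup_le_layerSubgroup m)
          (resGalSubgroupOfEmb κ.kerSubgroup (closureEmb (K := ℚ) (v.adicCompletion ℚ)) ⟨τ, hτ⟩)) : W.geomPrimaryTorsion p) : W.geomPoints) = τ • P - P := e1
    rw [e1', e2] at e4
    -- `(τP − P) − (τQ − Q) = τ ιB − ιB` ⇒ `τ R = R`
    have : τ • (P - Q - pointsMapOfEmb W (closureEmb (K := ℚ) (v.adicCompletion ℚ)) (B : W.geomPoints)) - (P - Q - pointsMapOfEmb W (closureEmb (K := ℚ) (v.adicCompletion ℚ)) (B : W.geomPoints)) = 0 := by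
      rw [smul_sub, smul_sub]
      calc τ • P - τ • Q - τ • pointsMapOfEmb W (closureEmb (K := ℚ) (v.adicCompletion ℚ)) ↑B - (P - Q - pointsMapOfEmb W (closureEmb (K := ℚ) (v.adicCompletion ℚ)) ↑B)
          = (τ • P - P - (τ • Q - Q)) - (τ • pointsMapOfEmb W (closureEmb (K := ℚ) (v.adicCompletion ℚ)) ↑B - pointsMapOfEmb W (closureEmb (K := ℚ) (v.adicCompletion ℚ)) ↑B) := by abel
        _ = 0 := by rw [e4, sub_self]
    exact sub_eq_zero.mp this
  -- (h) `p^{L₀} P = p^{L₀−k}·(p^k Q) + p^{L₀} R` in `E(ℚ_∞·ℚ_v)`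
  have hdecomp : (⟨(p ^ L₀ : ℕ) • P, localLayerPointsOfEmb_le_localTowerPointsOfEmb κ _ W m hP'⟩ :
        localTowerPointsOfEmb κ (closureEmb (K := ℚ) (v.adicCompletion ℚ)) W) =
      (p ^ (L₁ + j)) • ⟨(p ^ k) • Q, hQ⟩ + (p ^ L₀) • ⟨P - Q - pointsMapOfEmb W (closureEmb (K := ℚ) (v.adicCompletion ℚ)) (B : W.geomPoints), hR⟩ := by
    apply Subtype.ext
    change (p ^ L₀ : ℕ) • P = (p ^ (L₁ + j)) • ((p ^ k) • Q) + (p ^ L₀) • (P - Q - pointsMapOfEmb W (closureEmb (K := ℚ) (v.adicCompletion ℚ)) (B : W.geomPoints))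
    rw [smul_smul, ← pow_add, ← hL₀, smul_sub, smul_sub, ← map_nsmul, hBkill, map_zero, sub_zero]
    abel
  have hsum : L x ⟨(p ^ L₀ : ℕ) • P, localLayerPointsOfEmb_le_localTowerPointsOfEmb κ _ W m hP'⟩ =
      (p ^ (L₁ + j)) • L x ⟨(p ^ k) • Q, hQ⟩ + (p ^ L₀) • L x ⟨P - Q - pointsMapOfEmb W (closureEmb (K := ℚ) (v.adicCompletion ℚ)) (B : W.geomPoints), hR⟩ := by
    rw [hdecomp, map_add, map_nsmul, map_nsmul]
  -- (i) divisibility: `p^{L₀} ∣ p^{L₁+j} · w₀ + p^{L₀} · w₁` with `L₀ = L₁ + j + k` ⇒ `p^k ∣ w₀`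
  have hker : (p ^ (L₁ + j)) • L x ⟨(p ^ k) • Q, hQ⟩ +
      (p ^ L₀) • L x ⟨P - Q - pointsMapOfEmb W (closureEmb (K := ℚ) (v.adicCompletion ℚ)) (B : W.geomPoints), hR⟩ ∈ RingHom.ker (PadicInt.toZModPow L₀) := by
    rw [← hsum]; exact hval
  rw [PadicInt.ker_toZModPow, Ideal.mem_span_singleton, nsmul_eq_mul, nsmul_eq_mul, Nat.cast_pow, Nat.cast_pow,
    dvd_add_left (dvd_mul_right _ _), hL₀, pow_add] at hker
  have hne : (p : ℤ_[p]) ^ (L₁ + j) ≠ 0 := pow_ne_zero _ (Nat.cast_ne_zero.mpr hp.out.ne_zero)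
  have hk : (p : ℤ_[p]) ^ k ∣ L x ⟨(p ^ k) • Q, hQ⟩ := (mul_dvd_mul_iff_left hne).mp hker
  have hmem : L x ⟨(p ^ k) • Q, hQ⟩ ∈ RingHom.ker (PadicInt.toZModPow k) := by
    rw [PadicInt.ker_toZModPow, Ideal.mem_span_singleton]; exact hk
  exact hmem

/-- ★ **T-ORTH in the currency of t42's predicate ORTH, VERBATIM** (hand hF1♭-LIM/LEV interface, STATUS 2026-08-31 (D1)): for `w := L x`,
`∀ (s : Sel♭) (φ) (Q) (k) (hQ), [φ] = s → (Kummer identity at the chosen place) → toZModPow k (w (p^k Q)) = 0` (`Sel♭ ≤ Sel`,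
`sharpFlatSelmerInfty_le_selmerInfty`). [cite: Kobayashi2003, (7.17)–(7.21) (p. 12)] [cite: Sprung2012, Def. 7.11 (p. 1503)] -/
theorem orth_of_residue (hκ : κ.IsCyclotomic) (hv : (p : 𝓞 ℚ) ∈ v.asIdeal)
    {γ : absoluteGaloisGroup ℚ} (I : IwasawaH1Data W p κ γ)
    (L : I.H → (localTowerPointsOfEmb κ (closureEmb (K := ℚ) (v.adicCompletion ℚ)) W →+ ℤ_[p]))
    (hL : ∀ (x : I.H) (n k : ℕ) (Q : localPoints W (v.adicCompletion ℚ))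
        (hQ : Q ∈ localLayerPointsOfEmb κ (closureEmb (K := ℚ) (v.adicCompletion ℚ)) W n),
        PadicInt.toZModPow k (L x ⟨Q, localLayerPointsOfEmb_le_localTowerPointsOfEmb κ _ W n hQ⟩) =
          CyclotomicLayer.tatePairingPk W κ v n k (I.proj n x) ⟨Q, hQ⟩)
    {ap : ℤ} {g : absoluteGaloisGroup (v.adicCompletion ℚ)} {c : ℕ → localPoints W (v.adicCompletion ℚ)} (x : I.H) :
    ∀ (s : sharpFlatSelmerInfty W κ (closureEmb (K := ℚ) (v.adicCompletion ℚ)) ap g c .flat)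
      (φ : contOneCocycles (discreteTopRep κ.kerSubgroup (W.geomPrimaryTorsion p)))
      (Q : localPoints W (v.adicCompletion ℚ)) (k : ℕ)
      (hQ : (p ^ k) • Q ∈ localTowerPointsOfEmb κ (closureEmb (K := ℚ) (v.adicCompletion ℚ)) W),
      oneCocycleClass (discreteTopRep κ.kerSubgroup (W.geomPrimaryTorsion p)) φ = (s : W.subgroupH1 p κ.kerSubgroup) →
      (∀ τ : localSubgroupOfEmb κ.kerSubgroup (closureEmb (K := ℚ) (v.adicCompletion ℚ)),
        pointsMapOfEmb W (closureEmb (K := ℚ) (v.adicCompletion ℚ))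
            ((φ.1 (resGalSubgroupOfEmb κ.kerSubgroup _ τ) : W.geomPrimaryTorsion p) : W.geomPoints) =
          (τ : absoluteGaloisGroup (v.adicCompletion ℚ)) • Q - Q) →
      PadicInt.toZModPow k (L x ⟨(p ^ k) • Q, hQ⟩) = 0 :=
  fun s φ Q k hQ hφ hKum ↦ toZModPow_apply_eq_zero_of_mem_selmerInfty W κ v hκ hv I L hL x
    (sharpFlatSelmerInfty_le_selmerInfty W κ (closureEmb (K := ℚ) (v.adicCompletion ℚ)) ap g c .flat s.2) φ hφ Q k hQ hKum

/-- ★ **`toX (Col♭ (L x)) = 0` — «`range loc ⊆ ker toX`» of conjunct (8).**  For any map `J` on the functionals (e.g. `w ↦ (J w).2 = Col♭ w` of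
the joint Coleman map), any ♭ dual datum `D` (ANY key) and any `toX` with the Kummer values (V̄) of
`SSFlatPackage.exists_flatToXLinearMap_of_mul_eq_one` on ♭-Selmer data, `toX (J (L x)) = 0` for every `x ∈ I.H`: `D.toDual` is injective, every
`s ∈ Sel♭` has a Kummer datum at the chosen place (Def. 7.11 at `σ = 1`), and its value is `0` by T-ORTH.
[cite: Sprung2012, Def. 7.9, Def. 7.11 (p. 1503), Prop. 7.19 (p. 1505)] [cite: Kobayashi2003, (7.17)–(7.21) (p. 12)] -/
theorem toX_snd_apply_eq_zero (hκ : κ.IsCyclotomic) (hv : (p : 𝓞 ℚ) ∈ v.asIdeal)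
    {γ : absoluteGaloisGroup ℚ} (I : IwasawaH1Data W p κ γ)
    (L : I.H → (localTowerPointsOfEmb κ (closureEmb (K := ℚ) (v.adicCompletion ℚ)) W →+ ℤ_[p]))
    (hL : ∀ (x : I.H) (n k : ℕ) (Q : localPoints W (v.adicCompletion ℚ))
        (hQ : Q ∈ localLayerPointsOfEmb κ (closureEmb (K := ℚ) (v.adicCompletion ℚ)) W n),
        PadicInt.toZModPow k (L x ⟨Q, localLayerPointsOfEmb_le_localTowerPointsOfEmb κ _ W n hQ⟩) =
          CyclotomicLayer.tatePairingPk W κ v n k (I.proj n x) ⟨Q, hQ⟩)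
    {ap : ℤ} {g : absoluteGaloisGroup (v.adicCompletion ℚ)} {c : ℕ → localPoints W (v.adicCompletion ℚ)}
    {Λ' : Type*} (J : (localTowerPointsOfEmb κ (closureEmb (K := ℚ) (v.adicCompletion ℚ)) W →+ ℤ_[p]) → Λ')
    {δ : absoluteGaloisGroup ℚ}
    (D : SharpFlatSelmerDualData W κ δ (closureEmb (K := ℚ) (v.adicCompletion ℚ)) ap g c .flat) (toX : Λ' → D.X)
    (hV : ∀ (w : localTowerPointsOfEmb κ (closureEmb (K := ℚ) (v.adicCompletion ℚ)) W →+ ℤ_[p])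
        (s : sharpFlatSelmerInfty W κ (closureEmb (K := ℚ) (v.adicCompletion ℚ)) ap g c .flat)
        (φ : contOneCocycles (discreteTopRep κ.kerSubgroup (W.geomPrimaryTorsion p)))
        (Q : localPoints W (v.adicCompletion ℚ)) (k : ℕ)
        (hQ : (p ^ k) • Q ∈ localTowerPointsOfEmb κ (closureEmb (K := ℚ) (v.adicCompletion ℚ)) W),
        oneCocycleClass (discreteTopRep κ.kerSubgroup (W.geomPrimaryTorsion p)) φ = (s : W.subgroupH1 p κ.kerSubgroup) →
        (∀ τ : localSubgroupOfEmb κ.kerSubgroup (closureEmb (K := ℚ) (v.adicCompletion ℚ)),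
          pointsMapOfEmb W (closureEmb (K := ℚ) (v.adicCompletion ℚ))
              ((φ.1 (resGalSubgroupOfEmb κ.kerSubgroup _ τ) : W.geomPrimaryTorsion p) : W.geomPoints) =
            (τ : absoluteGaloisGroup (v.adicCompletion ℚ)) • Q - Q) →
        ∀ a : ℤ, PadicInt.toZModPow k (w ⟨(p ^ k) • Q, hQ⟩) = (a : ZMod (p ^ k)) →
          D.toDual (toX (J w)) s = (((a : ℚ) / (p : ℚ) ^ k : ℚ) : AddCircle (1 : ℚ)))
    (x : I.H) : toX (J (L x)) = 0 := by
  apply D.bijective.1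
  rw [map_zero]
  refine AddMonoidHom.ext fun s ↦ ?_
  -- a Kummer datum of `s` at the chosen place (`σ = 1` in Def. 7.11)
  have hs := (mem_sharpFlatSelmerInfty_iff W κ (closureEmb (K := ℚ) (v.adicCompletion ℚ)) ap g c .flat
    (s : W.subgroupH1 p κ.kerSubgroup)).1 s.2
  have h1 := hs.2 1
  rw [W.conjH1_one_holds p κ.kerSubgroup, AddMonoidHom.id_apply] at h1
  obtain ⟨φ, Q, k, hQ, hφ, -, hτ⟩ := (mem_sharpFlatLocalKummerOverOfEmb_iff _ _ _).1 h1
  have h0 := toZModPow_apply_eq_zero_of_mem_selmerInfty W κ v hκ hv I L hL x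
    (sharpFlatSelmerInfty_le_selmerInfty W κ (closureEmb (K := ℚ) (v.adicCompletion ℚ)) ap g c .flat s.2) φ hφ Q k hQ hτ
  have h := hV (L x) s φ Q k hQ hφ hτ 0 (by rw [h0, Int.cast_zero])
  rw [AddMonoidHom.zero_apply, h, Int.cast_zero, zero_div, AddCircle.coe_zero]

end Orth

end SSFlatPT

end Summit.BirchSwinnertonDyer.BirchSwinnertonDyer.Theorems

end
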